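import Mathlib
import Literature.Analysis.Calculus.UniformC1Composition
import Literature.Analysis.Calculus.GraphReparametrization
import Literature.Topology.PlaneTopology.ZerosPersist
import HarnessLib

/-!
# Persistence of a positive-index intersection of two sheets under perturbation

The topological half of "limits of embedded `J`-holomorphic curves are embedded" at a double
point (McDuff (1991), Lemma 4.3 / Lemma 4.2(ii): the self-intersection number of a map of the
disc is unchanged under `C¹`-small perturbation; here in the local, two-sheet form that the
similarity principle delivers). Everything is read in a chart `e : ℂ × ℂ ≃ₗₒ꜀ F` (an
`OpenPartialHomeomorph` with `C¹` inverse `Φ = e.symm` on its target — for `J`-curves, the sheet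
chart of `Literature/Geometry/Symplectic/JHolomorphicSheetChart*.lean`) in which the first sheet
`b` is the axis: `e (z, 0) = b z` for `z ∈ B̄(z₁, δ₁)`. The second sheet `v`, continuous on a closed
disc `B̄(z₂, ε)` with values in the target, has chart coordinates `Φ (v ζ) = (a ζ, c ζ)`; assume
the normal coordinate `c` has no zero on the circle `‖ζ - z₂‖ = ε` and NON-ZERO WINDING NUMBER
along it (an isolated intersection of non-zero index at `v z₂ = b z₁`), and that `a` maps the disc
well inside `B(z₁, δ₁)`. Let `bₙ → b` in `C¹` on `B̄(z₁, δ₁)` and `vₙ → v` uniformly on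
`B̄(z₂, ε)`. Then for all large `n` the perturbed sheets still meet:
`vₙ ζ' = bₙ ζ` for some `ζ' ∈ B̄(z₂, ε)`, `ζ ∈ B(z₁, δ₁)` (`eventually_exists_eq_of_wind_ne_zero`).

Proof: `Φ ∘ bₙ → Φ ∘ b = (id, 0)` in `C¹` (`tendstoUniformlyOn_fderiv_comp_of_isCompact`), so the
image of `Φ ∘ bₙ` contains the graph of a small continuous `gₙ` over `B̄(z₁, δ₁/16)`
(`eventually_exists_graph`); `Φ ∘ vₙ → (a, c)` uniformly (`tendstoUniformlyOn_comp_of_isCompact`),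
so `c̃ₙ := (Φ vₙ).2 - gₙ ((Φ vₙ).1) → c` uniformly on the disc and is continuous; by Rouché–Brouwer
(`exists_zero_of_norm_sub_lt_on_sphere`) `c̃ₙ` has a zero `ζ'`, i.e. `Φ (vₙ ζ')` lies on the graph,
i.e. `Φ (vₙ ζ') = Φ (bₙ ζ)`, and `Φ` is injective on the target.

## References

* D. McDuff, *The local behaviour of holomorphic curves in almost complex 4-manifolds*,
  J. Differential Geom. 34 (1991), Lemma 4.2(ii), Lemma 4.3. [McDuff1991LocalBehaviour]
-/

noncomputable section

open scoped Topology NNReal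
open Set Function Metric Filter
open Literature.Analysis.Calculus Literature.Topology.PlaneTopology

namespace Literature.Geometry.Symplectic

variable {F : Type*} [NormedAddCommGroup F] [NormedSpace ℝ F] [FiniteDimensional ℝ F]

/-- Values of a uniformly convergent sequence eventually lie in an open set containing the
compact closure-image of the limit. [folklore] -/
theorem eventually_mem_of_tendstoUniformlyOn {X : Type*} {G : Type*} [PseudoMetricSpace G]
    [ProperSpace G] {U K : Set G} (hU : IsOpen U) (hK : IsCompact K) (hKU : K ⊆ U)
    {f : X → G} {Fn : ℕ → X → G} {s : Set X} (hfs : ∀ x ∈ s, f x ∈ K)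
    (hF : TendstoUniformlyOn Fn f atTop s) : ∀ᶠ n in atTop, ∀ x ∈ s, Fn n x ∈ U := by
  obtain ⟨δ, hδ, hδU⟩ := hK.exists_cthickening_subset_open hU hKU
  filter_upwards [Metric.tendstoUniformlyOn_iff.1 hF δ hδ] with n hn x hx
  exact hδU (mem_cthickening_of_dist_le _ (f x) _ _ (hfs x hx)
    (by rw [dist_comm]; exact (hn x hx).le))

/-- **Persistence of an intersection of non-zero index.** See the module docstring: in a chart
`e` (with `C¹` inverse on its target) in which the first sheet is the axis, a second sheet whose
normal coordinate winds non-trivially around a zero keeps meeting `C¹`-perturbations of the first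
sheet after `C⁰`-perturbation. [cite: McDuff1991LocalBehaviour, Lemma 4.2(ii) and Lemma 4.3] -/
theorem eventually_exists_eq_of_wind_ne_zero (e : OpenPartialHomeomorph (ℂ × ℂ) F)
    (hΦ : ContDiffOn ℝ 1 e.symm e.target)
    {b : ℂ → F} {z₁ : ℂ} {δ₁ : ℝ} (hδ₁ : 0 < δ₁)
    (hbsrc : ∀ z ∈ closedBall z₁ δ₁, ((z, 0) : ℂ × ℂ) ∈ e.source ∧ e (z, 0) = b z)
    (hbd : ∀ z ∈ closedBall z₁ δ₁, DifferentiableAt ℝ b z) {C : ℝ}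
    (hbC : ∀ z ∈ closedBall z₁ δ₁, ‖fderiv ℝ b z‖ ≤ C)
    {bn : ℕ → ℂ → F} (hbn : TendstoUniformlyOn bn b atTop (closedBall z₁ δ₁))
    (hdbn : TendstoUniformlyOn (fun n z => fderiv ℝ (bn n) z) (fun z => fderiv ℝ b z) atTop
      (closedBall z₁ δ₁))
    (hbnd : ∀ᶠ n in atTop, ∀ z ∈ closedBall z₁ δ₁, DifferentiableAt ℝ (bn n) z)
    {v : ℂ → F} {z₂ : ℂ} {ε : ℝ} (hε : 0 < ε)
    (hvt : ∀ ζ ∈ closedBall z₂ ε, v ζ ∈ e.target) (hvc : ContinuousOn v (closedBall z₂ ε))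
    (hcne : ∀ ζ : ℂ, ‖ζ - z₂‖ = ε → (e.symm (v ζ)).2 ≠ 0)
    (hwind : wind (fun t => (e.symm (v (circleLoop z₂ ε t))).2) ≠ 0)
    (ha : ∀ ζ ∈ closedBall z₂ ε, ‖(e.symm (v ζ)).1 - z₁‖ < δ₁ / 32)
    {vn : ℕ → ℂ → F} (hvn : TendstoUniformlyOn vn v atTop (closedBall z₂ ε))
    (hvnc : ∀ᶠ n in atTop, ContinuousOn (vn n) (closedBall z₂ ε)) :
    ∀ᶠ n in atTop, ∃ ζ' ∈ closedBall z₂ ε, ∃ ζ ∈ ball z₁ δ₁, vn n ζ' = bn n ζ := by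
  set Φ : F → ℂ × ℂ := ⇑e.symm with hΦ_def
  set S := closedBall z₂ ε with hS
  set D₁ := closedBall z₁ δ₁ with hD₁
  -- compact images of the limits inside the (open) target
  have hK₁ : IsCompact (b '' D₁) := by
    have hbc : ContinuousOn b D₁ := fun z hz => (hbd z hz).continuousAt.continuousWithinAt
    exact (isCompact_closedBall z₁ δ₁).image_of_continuousOn hbc
  have hK₁t : b '' D₁ ⊆ e.target := by
    rintro _ ⟨z, hz, rfl⟩
    rw [← (hbsrc z hz).2]
    exact e.map_source (hbsrc z hz).1
  have hK₂ : IsCompact (v '' S) := (isCompact_closedBall z₂ ε).image_of_continuousOn hvc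
  have hK₂t : v '' S ⊆ e.target := by
    rintro _ ⟨ζ, hζ, rfl⟩
    exact hvt ζ hζ
  -- `Φ ∘ b = (id, 0)` on `D₁`, with derivative `inl` on the open ball
  have hΦb : ∀ z ∈ D₁, Φ (b z) = (z, 0) := fun z hz => by
    rw [hΦ_def, ← (hbsrc z hz).2]
    exact e.left_inv (hbsrc z hz).1
  -- (i) `Φ ∘ bn → Φ ∘ b` uniformly and in `C¹` on `D₁`
  have hc0 : TendstoUniformlyOn (fun n z => Φ (bn n z)) (fun z => Φ (b z)) atTop D₁ :=
    tendstoUniformlyOn_comp_of_isCompact e.open_target hΦ.continuousOn hK₁ hK₁t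
      (fun z hz => mem_image_of_mem b hz) hbn
  have hc1 : TendstoUniformlyOn (fun n z => fderiv ℝ (fun y => Φ (bn n y)) z)
      (fun z => fderiv ℝ (fun y => Φ (b y)) z) atTop D₁ :=
    tendstoUniformlyOn_fderiv_comp_of_isCompact e.open_target hΦ hK₁ hK₁t
      (fun z hz => mem_image_of_mem b hz) hbn hdbn hbnd hbd hbC
  -- restrict to the smaller closed disc `D := B̄(z₁, δ₁/2)`, where `fderiv (Φ ∘ b) = inl`
  set ρ : ℝ := δ₁ / 2 with hρ_def
  have hρ : 0 < ρ := by positivity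
  have hDD₁ : closedBall z₁ ρ ⊆ ball z₁ δ₁ := closedBall_subset_ball (by rw [hρ_def]; linarith)
  have hDD₁' : closedBall z₁ ρ ⊆ D₁ := hDD₁.trans ball_subset_closedBall
  have hinl : ∀ z ∈ closedBall z₁ ρ,
      fderiv ℝ (fun y => Φ (b y)) z = ContinuousLinearMap.inl ℝ ℂ ℂ := by
    intro z hz
    have heq : (fun y => Φ (b y)) =ᶠ[𝓝 z] fun y => ((y, 0) : ℂ × ℂ) := by
      filter_upwards [isOpen_ball.mem_nhds (hDD₁ hz)] with y hy
      exact hΦb y (ball_subset_closedBall hy)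
    rw [heq.fderiv_eq]
    exact ((ContinuousLinearMap.inl ℝ ℂ ℂ).hasFDerivAt).fderiv
  have h0 : TendstoUniformlyOn (fun n z => Φ (bn n z)) (fun z => ((z, 0) : ℂ × ℂ)) atTop
      (closedBall z₁ ρ) := by
    refine (hc0.mono hDD₁').congr_right fun z hz => ?_
    exact hΦb z (hDD₁' hz)
  have h1 : TendstoUniformlyOn (fun n z => fderiv ℝ (fun y => Φ (bn n y)) z)
      (fun _ => ContinuousLinearMap.inl ℝ ℂ ℂ) atTop (closedBall z₁ ρ) :=
    (hc1.mono hDD₁').congr_right fun z hz => hinl z hz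
  -- eventually `bn` maps `D₁` into the target, hence `Φ ∘ bn` is differentiable on `D₁`
  have hbnt : ∀ᶠ n in atTop, ∀ z ∈ D₁, bn n z ∈ e.target :=
    eventually_mem_of_tendstoUniformlyOn e.open_target hK₁ hK₁t
      (fun z hz => mem_image_of_mem b hz) hbn
  have hd : ∀ᶠ n in atTop, ∀ z ∈ closedBall z₁ ρ, DifferentiableAt ℝ (fun y => Φ (bn n y)) z := by
    filter_upwards [hbnt, hbnd] with n hnt hnd z hz
    exact ((hΦ.differentiableOn one_ne_zero).differentiableAt
      (e.open_target.mem_nhds (hnt z (hDD₁' hz)))).comp z (hnd z (hDD₁' hz))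
  -- (ii) `Φ ∘ vn → Φ ∘ v` uniformly on `S`; eventually `vn` maps `S` into the target
  have hw0 : TendstoUniformlyOn (fun n ζ => Φ (vn n ζ)) (fun ζ => Φ (v ζ)) atTop S :=
    tendstoUniformlyOn_comp_of_isCompact e.open_target hΦ.continuousOn hK₂ hK₂t
      (fun ζ hζ => mem_image_of_mem v hζ) hvn
  have hvnt : ∀ᶠ n in atTop, ∀ ζ ∈ S, vn n ζ ∈ e.target :=
    eventually_mem_of_tendstoUniformlyOn e.open_target hK₂ hK₂t
      (fun ζ hζ => mem_image_of_mem v hζ) hvn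
  -- a positive lower bound `m` of `‖c‖` on the circle, `c = (Φ ∘ v).2`
  set c : ℂ → ℂ := fun ζ => (Φ (v ζ)).2 with hc_def
  have hΦvc : ContinuousOn (fun ζ => Φ (v ζ)) S :=
    hΦ.continuousOn.comp hvc fun ζ hζ => hvt ζ hζ
  have hcc : ContinuousOn c S := continuous_snd.comp_continuousOn hΦvc
  have hsphS : sphere z₂ ε ⊆ S := sphere_subset_closedBall
  obtain ⟨m, hm0, hm⟩ : ∃ m : ℝ, 0 < m ∧ ∀ ζ ∈ sphere z₂ ε, m ≤ ‖c ζ‖ := by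
    obtain ⟨ζ₀, hζ₀, hmin⟩ := (isCompact_sphere z₂ ε).exists_isMinOn
      ⟨z₂ + ε, by simp [hε.le]⟩ (hcc.mono hsphS).norm
    refine ⟨‖c ζ₀‖, norm_pos_iff.2 (hcne ζ₀ ?_), fun ζ hζ => hmin hζ⟩
    simpa [dist_eq_norm] using hζ₀
  -- the graph functions: smallness `η := m / 2`
  have hgraph := eventually_exists_graph hρ h0 h1 hd (half_pos hm0)
  have hρ16 : ρ / 16 = δ₁ / 32 := by rw [hρ_def]; ring
  -- the margin `θ := δ₁/32 - max ‖a - z₁‖ > 0` (max over the compact disc)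
  have hacont : ContinuousOn (fun ζ => ‖(Φ (v ζ)).1 - z₁‖) S :=
    ((continuous_fst.comp_continuousOn hΦvc).sub continuousOn_const).norm
  obtain ⟨ζm, hζm, hmax⟩ := (isCompact_closedBall z₂ ε).exists_isMaxOn
    ⟨z₂, mem_closedBall_self hε.le⟩ hacont
  set θ : ℝ := δ₁ / 32 - ‖(Φ (v ζm)).1 - z₁‖ with hθ_def
  have hθ : 0 < θ := sub_pos.2 (ha ζm hζm)
  -- assemble
  filter_upwards [hgraph, Metric.tendstoUniformlyOn_iff.1 hw0 (min (m / 2) θ) (lt_min (half_pos hm0) hθ),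
    hvnt, hbnt, hvnc] with n ⟨g, hgc, hg⟩ hn2 hnt hbt hvc'
  -- the corrected normal coordinate of `vn`
  set p : ℂ → ℂ × ℂ := fun ζ => Φ (vn n ζ) with hp_def
  set d : ℂ → ℂ := fun ζ => (p ζ).2 - g (p ζ).1 with hd_def
  -- `p ζ` is close to `Φ (v ζ)`; its first coordinate lies in `B̄(z₁, ρ/16)`
  have hp1 : ∀ ζ ∈ S, (p ζ).1 ∈ closedBall z₁ (ρ / 16) := by
    intro ζ hζ
    have h := hn2 ζ hζ
    rw [dist_eq_norm] at h
    have hle : ‖(Φ (v ζ)).1 - z₁‖ ≤ ‖(Φ (v ζm)).1 - z₁‖ := hmax hζ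
    rw [mem_closedBall, dist_eq_norm, hρ16]
    calc ‖(p ζ).1 - z₁‖ = ‖((p ζ).1 - (Φ (v ζ)).1) + ((Φ (v ζ)).1 - z₁)‖ := by ring_nf
      _ ≤ ‖(p ζ).1 - (Φ (v ζ)).1‖ + ‖(Φ (v ζ)).1 - z₁‖ := norm_add_le _ _
      _ ≤ ‖Φ (v ζ) - p ζ‖ + ‖(Φ (v ζ)).1 - z₁‖ := by
          gcongr
          rw [← norm_neg, neg_sub]
          exact norm_fst_le (Φ (v ζ) - p ζ)
      _ ≤ δ₁ / 32 := by
          have := (h.le.trans (min_le_right _ _))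
          rw [hθ_def] at this
          linarith
  -- `d` is continuous on `S` and close to `c` on the circle
  have hpc : ContinuousOn p S := hΦ.continuousOn.comp hvc' fun ζ hζ => hnt ζ hζ
  have hdc : ContinuousOn d S :=
    (continuous_snd.comp_continuousOn hpc).sub
      (hgc.comp (continuous_fst.comp_continuousOn hpc) hp1)
  have hclose : ∀ ζ ∈ sphere z₂ ε, ‖d ζ - c ζ‖ < ‖c ζ‖ := by
    intro ζ hζ
    have hζS := hsphS hζ
    have h := hn2 ζ hζS
    rw [dist_eq_norm] at h
    have h2 : ‖(p ζ).2 - c ζ‖ ≤ ‖Φ (v ζ) - p ζ‖ := by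
      rw [← norm_neg, neg_sub]
      exact norm_snd_le (Φ (v ζ) - p ζ)
    have h3 : ‖g (p ζ).1‖ < m / 2 := (hg _ (hp1 ζ hζS)).1
    calc ‖d ζ - c ζ‖ = ‖((p ζ).2 - c ζ) - g (p ζ).1‖ := by rw [hd_def]; ring_nf
      _ ≤ ‖(p ζ).2 - c ζ‖ + ‖g (p ζ).1‖ := norm_sub_le _ _
      _ < m / 2 + m / 2 := add_lt_add_of_le_of_lt (h2.trans (h.le.trans (min_le_left _ _))) h3
      _ = m := by ring
      _ ≤ ‖c ζ‖ := hm ζ hζ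
  -- Rouché–Brouwer: `d` has a zero `ζ'` in the closed disc
  obtain ⟨ζ', hζ'S, hζ'0⟩ := exists_zero_of_norm_sub_lt_on_sphere hε (hcc.mono hsphS) hwind hdc
    hclose
  -- the zero lies on the graph: `p ζ' = (α, g α) = Φ (bn ζ)`
  obtain ⟨-, ζ, hζ, hζeq⟩ := hg _ (hp1 ζ' hζ'S)
  refine ⟨ζ', hζ'S, ζ, ball_subset_ball (by rw [hρ_def]; linarith) hζ, ?_⟩
  have hpeq : p ζ' = Φ (bn n ζ) := by
    rw [hζeq]
    refine Prod.ext rfl ?_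
    have : (p ζ').2 - g (p ζ').1 = 0 := hζ'0
    exact (sub_eq_zero.1 this)
  -- `Φ = e.symm` is injective on the target
  have hζD₁ : ζ ∈ D₁ := ball_subset_closedBall (ball_subset_ball (by rw [hρ_def]; linarith) hζ)
  calc vn n ζ' = e (Φ (vn n ζ')) := (e.right_inv (hnt ζ' hζ'S)).symm
    _ = e (Φ (bn n ζ)) := congrArg e hpeq
    _ = bn n ζ := e.right_inv (hbt ζ hζD₁)

end Literature.Geometry.Symplectic

end
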